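import Summits.ResolutionOfSingularities.ResolutionOfSingularities.Theorems.FrobeniusLadderFRationalResolutionGaloisTwistInvariants
import Mathlib.RingTheory.Invariant.Basic
import HarnessLib

/-!
# Crux `FrobeniusLadder.FRationalResolution` (stmt-ResolutionOfSingularities-15317), line `redirect`,
# stub `stub_diagonalizableQuotientResolution` — the decomposition group SURJECTS onto the `B`-automorphisms of the residue
# ring `κ(𝔔') = (B ⊗_K K')/𝔔'` (item [M] «D ↠ Aut(κ(𝔔')/κ(𝔭))» of MEMO-15317-leafhand2-g14 §3)

For `K'/K` finite Galois, `B' = B ⊗_K K'` with its twists `1 ⊗ σ`, and a prime `𝔔' ⊆ B'`: every ring automorphism `f` of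
`B'/𝔔'` fixing the image of `B` is induced by a twist `1 ⊗ σ` with `σ` in the DECOMPOSITION GROUP of `𝔔'` (`(1 ⊗ σ) 𝔔' = 𝔔'`):
`f(x̄) = \overline{(1 ⊗ σ) x}`. This is Mathlib's `Ideal.Quotient.stabilizerHom_surjective` for the twist action, whose ring of
invariants is `B` (✓ `…GaloisTwistInvariants.exists_eq_tmul_one_of_forall_map_eq`).

* **`exists_twist_of_residue_ringEquiv`** — the statement above.

Use in the route: with the stabilizer criterion ✓ `…GaloisResiduePointEmbedding.map_chartTwist_eq_iff` (`σ''(𝔚) = 𝔚 ↔ σ̄ ∘ ι = ι`)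
it converts the hypothesis `hfix` of ✓ `…GaloisFixedPointPiece` («every chart twist of the decomposition group fixes the
trivial-residue point `𝔚` belonging to `ι : κ(𝔔) → κ(𝔔')`») into the field-theoretic statement «every `κ(𝔭)`-automorphism of
`κ(𝔔')` fixes `ι` pointwise», i.e. `ι(κ(𝔔)) ⊆ κ(𝔔')^{Aut(κ(𝔔')/κ(𝔭))}` — for an étale chart and `K'` splitting the residue data this
is the residue-trivial case `κ(𝔔) = κ(𝔭)`: at a genuinely twisted point no unsymmetrized piece is decomposition-stable by a choice
of point.

Honest label: plumbing toward ONE leaf stub (no stub, crux or summit closed). No definitions, no named facts, no sorry.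
[cite: StacksProject, Tag 09EB; Tag 0CDQ; Tag 0BRI]
-/

noncomputable section

-- single-problem summit: the doubled namespace component is forced
set_option linter.dupNamespace false

open TensorProduct
open scoped Pointwise

namespace Summit.ResolutionOfSingularities.ResolutionOfSingularities.Theorems.FRationalResolution.GaloisResidueAutomorphisms

variable {K K' B : Type} [Field K] [Field K'] [Algebra K K'] [CommRing B] [Algebra K B]

/-- **The decomposition group surjects onto `Aut_B(B'/𝔔')`.** For `K'/K` finite Galois, a prime `𝔔' ⊆ B ⊗_K K'`, and a ring
automorphism `f` of `(B ⊗_K K')/𝔔'` fixing the classes of the elements `b ⊗ 1`, there is `σ ∈ Aut_K(K')` with `(1 ⊗ σ) 𝔔' = 𝔔'`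
inducing `f`: `f(x̄) = \overline{(1 ⊗ σ) x}` for all `x`. [cite: StacksProject, Tag 0BRI; Tag 09EB] -/
theorem exists_twist_of_residue_ringEquiv [FiniteDimensional K K'] [IsGalois K K'] (𝔔' : Ideal (B ⊗[K] K'))
    [𝔔'.IsPrime] (f : (B ⊗[K] K') ⧸ 𝔔' ≃+* (B ⊗[K] K') ⧸ 𝔔')
    (hf : ∀ b : B, f (Ideal.Quotient.mk 𝔔' (algebraMap B (B ⊗[K] K') b)) =
      Ideal.Quotient.mk 𝔔' (algebraMap B (B ⊗[K] K') b)) :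
    ∃ σ : K' ≃ₐ[K] K',
      𝔔'.map (Algebra.TensorProduct.map (AlgHom.id B B) (σ : K' →ₐ[K] K')) = 𝔔' ∧
      ∀ x : B ⊗[K] K', f (Ideal.Quotient.mk 𝔔' x) =
        Ideal.Quotient.mk 𝔔' (Algebra.TensorProduct.map (AlgHom.id B B) (σ : K' →ₐ[K] K') x) := by
  classical
  -- the twist action as a monoid hom into the ring automorphisms (as in `…GaloisTwistInvariants`)
  let τ : (K' ≃ₐ[K] K') → (B ⊗[K] K' ≃ₐ[B] B ⊗[K] K') := fun σ =>
    Algebra.TensorProduct.congr (AlgEquiv.refl : B ≃ₐ[B] B) σ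
  have hτ : ∀ σ x, τ σ x = Algebra.TensorProduct.map (AlgHom.id B B) (σ : K' →ₐ[K] K') x := by
    intro σ x
    induction x using TensorProduct.induction_on with
    | zero => simp
    | tmul b y => simp [τ, Algebra.TensorProduct.congr_apply, Algebra.TensorProduct.map_tmul]
    | add x y hx hy => rw [map_add, map_add, hx, hy]
  have hone : ∀ x, τ 1 x = x := by
    intro x
    rw [hτ]
    induction x using TensorProduct.induction_on with
    | zero => simp
    | tmul b y => simp [Algebra.TensorProduct.map_tmul]
    | add x y hx hy => rw [map_add, hx, hy]
  have hmul : ∀ σ σ' x, τ (σ * σ') x = τ σ (τ σ' x) := by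
    intro σ σ' x
    rw [hτ, hτ, hτ]
    induction x using TensorProduct.induction_on with
    | zero => simp
    | tmul b y => simp [Algebra.TensorProduct.map_tmul, AlgEquiv.mul_apply]
    | add x y hx hy => simp only [map_add, hx, hy]
  let φ : (K' ≃ₐ[K] K') →* RingAut (B ⊗[K] K') :=
    { toFun := fun σ => (τ σ).toRingEquiv
      map_one' := by
        ext x
        exact hone x
      map_mul' := fun σ σ' => by
        ext x
        exact hmul σ σ' x }
  have hφ : ∀ σ x, φ σ x = Algebra.TensorProduct.map (AlgHom.id B B) (σ : K' →ₐ[K] K') x := fun σ x => hτ σ x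
  letI : MulSemiringAction (K' ≃ₐ[K] K') (B ⊗[K] K') := MulSemiringAction.compHom (B ⊗[K] K') φ
  have hsmul : ∀ (σ : K' ≃ₐ[K] K') (x : B ⊗[K] K'),
      σ • x = Algebra.TensorProduct.map (AlgHom.id B B) (σ : K' →ₐ[K] K') x := fun σ x => hφ σ x
  haveI : SMulCommClass (K' ≃ₐ[K] K') B (B ⊗[K] K') :=
    ⟨fun σ b x => by rw [hsmul, hsmul, map_smul]⟩
  haveI : Algebra.IsInvariant B (B ⊗[K] K') (K' ≃ₐ[K] K') :=
    ⟨fun x hx => by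
      obtain ⟨b, hb⟩ := GaloisTwistInvariants.exists_eq_tmul_one_of_forall_map_eq x fun σ => by
        rw [← hsmul]; exact hx σ
      exact ⟨b, by rw [hb, Algebra.TensorProduct.algebraMap_apply, Algebra.algebraMap_self, RingHom.id_apply]⟩⟩
  -- `f` as an algebra automorphism over `B ⧸ (𝔔' ∩ B)`
  let F : ((B ⊗[K] K') ⧸ 𝔔') ≃ₐ[B ⧸ 𝔔'.under B] ((B ⊗[K] K') ⧸ 𝔔') :=
    { f with
      commutes' := fun r => by
        obtain ⟨b, rfl⟩ := Ideal.Quotient.mk_surjective r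
        show f (algebraMap (B ⧸ 𝔔'.under B) ((B ⊗[K] K') ⧸ 𝔔') (Ideal.Quotient.mk (𝔔'.under B) b)) =
          algebraMap (B ⧸ 𝔔'.under B) ((B ⊗[K] K') ⧸ 𝔔') (Ideal.Quotient.mk (𝔔'.under B) b)
        rw [Ideal.Quotient.algebraMap_mk_of_liesOver]
        exact hf b }
  have hF : ∀ y, F y = f y := fun y => rfl
  obtain ⟨g, hg⟩ := Ideal.Quotient.stabilizerHom_surjective (K' ≃ₐ[K] K') (𝔔'.under B) 𝔔' F
  refine ⟨(g : K' ≃ₐ[K] K'), ?_, fun x => ?_⟩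
  · have hg𝔔 : (g : K' ≃ₐ[K] K') • 𝔔' = 𝔔' := MulAction.mem_stabilizer_iff.mp g.2
    rw [Ideal.pointwise_smul_def] at hg𝔔
    conv_rhs => rw [← hg𝔔]
    -- both sides are the span of the same image
    apply le_antisymm
    · rw [Ideal.map_le_iff_le_comap]
      intro x hx
      rw [Ideal.mem_comap]
      have : Algebra.TensorProduct.map (AlgHom.id B B) ((g : K' ≃ₐ[K] K') : K' →ₐ[K] K') x =
          MulSemiringAction.toRingHom (K' ≃ₐ[K] K') (B ⊗[K] K') g x := (hsmul g x).symm
      rw [this]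
      exact Ideal.mem_map_of_mem _ hx
    · rw [Ideal.map_le_iff_le_comap]
      intro x hx
      rw [Ideal.mem_comap]
      have : MulSemiringAction.toRingHom (K' ≃ₐ[K] K') (B ⊗[K] K') g x =
          Algebra.TensorProduct.map (AlgHom.id B B) ((g : K' ≃ₐ[K] K') : K' →ₐ[K] K') x := hsmul g x
      rw [this]
      exact Ideal.mem_map_of_mem _ hx
  · have h := AlgEquiv.congr_fun hg (Ideal.Quotient.mk 𝔔' x)
    have h' : Ideal.Quotient.stabilizerHom 𝔔' (𝔔'.under B) (K' ≃ₐ[K] K') g (Ideal.Quotient.mk 𝔔' x) =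
        Ideal.Quotient.mk 𝔔' ((g : K' ≃ₐ[K] K') • x) := rfl
    rw [hF, h', hsmul] at h
    exact h.symm

end Summit.ResolutionOfSingularities.ResolutionOfSingularities.Theorems.FRationalResolution.GaloisResidueAutomorphisms

end
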